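import Summits.SmoothPoincare4.SmoothPoincare4.Theorems.SullivanDualTargetCroftonPencilDefs

/-!
# Helper `helper_lineEnergy_le_of_immersion` of the line `crofton-pencil-laminar-charge`
(crux `Target`, item stmt-SmoothPoincare4-7823, route route-SmoothPoincare4-SullivanDual)

COMPARABILITY OF ENERGIES. For a smooth immersion `ι₁ : Σ → ℝ^{N₁}` and any smooth map
`ι₂ : Σ → ℝ^{N₂}` of the compact manifold `Σ = S.carrier`, there is one constant `C : ℝ≥0` with
`lineEnergy ι₂ u ≤ C · lineEnergy ι₁ u` for every smooth curve `u : ℂ → Σ ∖ p`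
(`lineEnergy ι u = ∫⁻ ‖d(ι ∘ u)‖²`). This is the remark "fix a convenient smooth immersion — all
give comparable energies since `Σ` is compact" opening the two big stubs of the line.

Proof.
* KEY ESTIMATE (`exists_norm_fderiv_chart_le`). Read both maps in the extended chart `e₀` at a
  point `x₀`: `Fᵢ = ιᵢ ∘ e₀.symm` is `C^∞` on the open chart target, so `y ↦ DFᵢ(y)` is continuous
  there. At the centre, `DF₁(e₀ x₀)` is injective, because `Dι₁(x₀) = DF₁(e₀ x₀) ∘ De₀(x₀)` with
  `De₀(x₀)` invertible and `Dι₁(x₀)` injective; an injective linear map of the finite-dimensional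
  `ℝ⁴` is bounded below, `‖w‖ ≤ K ‖DF₁(e₀ x₀) w‖`. By continuity, for `y` near `e₀ x₀` we have
  `‖DF₁(y) − DF₁(e₀ x₀)‖ K ≤ 1/2` and `‖DF₂(y)‖ ≤ ‖DF₂(e₀ x₀)‖ + 1 =: M`, whence
  `‖w‖ ≤ 2K ‖DF₁(y) w‖` and `‖DF₂(y) w‖ ≤ 2KM ‖DF₁(y) w‖` for all `w`. Pulling back by the
  continuous `e₀` gives a neighbourhood of `x₀`; finitely many of them cover the compact `Σ`
  (`CompactSpace.elim_nhds_subcover`), and the sum of the (nonnegative parts of the) constants works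
  for every point.
* ENERGY (`norm_fderiv_curve_le`). For a smooth curve `u`, at each `ξ` pick the chart `e₀` given by
  the key estimate at `x = u ξ`; near `ξ`, `ιᵢ ∘ u = Fᵢ ∘ (e₀ ∘ u)`, so by the chain rule
  `d(ιᵢ ∘ u)(ξ) = DFᵢ(e₀ x) ∘ d(e₀ ∘ u)(ξ)` with the SAME inner derivative for `i = 1, 2`; hence
  `‖d(ι₂ ∘ u)(ξ)‖ ≤ C ‖d(ι₁ ∘ u)(ξ)‖`, and squaring and integrating gives the claim with constant
  `C²`.
-/

noncomputable section

-- the prescribed namespace `Summit.<P>.<Sub>.…` duplicates `SmoothPoincare4` (P = Sub)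
set_option linter.dupNamespace false

open scoped Manifold ContDiff Topology ENNReal NNReal
open Set Filter MeasureTheory Literature.Geometry.Kaehler Literature.Geometry.Symplectic
  Literature.Topology.FourManifolds
open Summit.SmoothPoincare4.SmoothPoincare4.Theorems.WitnessCharge.PencilIncompleteness

namespace Summit.SmoothPoincare4.SmoothPoincare4.Theorems.Target.CroftonPencil

variable {S : HomotopySphere 4}

/-! ### A smooth map read in one extended chart -/

section Chart

variable {N : ℕ} {ι : S.carrier → EuclideanSpace ℝ (Fin N)}

/-- For a smooth `ι : Σ → ℝᴺ`, the map `ι ∘ e₀.symm` is `C^∞` on the (open) target of the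
extended chart `e₀` at `x₀`. -/
theorem contDiffOn_comp_extChartAt_symm (hι : ContMDiff (𝓡 4) 𝓘(ℝ, EuclideanSpace ℝ (Fin N)) ∞ ι)
    (x₀ : S.carrier) :
    ContDiffOn ℝ ∞ (ι ∘ (extChartAt (𝓡 4) x₀).symm) (extChartAt (𝓡 4) x₀).target :=
  contMDiffOn_iff_contDiffOn.1
    (hι.comp_contMDiffOn (contMDiffOn_extChartAt_symm (I := 𝓡 4) (n := ∞) x₀))

/-- `ι ∘ e₀.symm` is differentiable at every point of the chart target. -/
theorem differentiableAt_comp_extChartAt_symm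
    (hι : ContMDiff (𝓡 4) 𝓘(ℝ, EuclideanSpace ℝ (Fin N)) ∞ ι) (x₀ : S.carrier)
    {y : EuclideanSpace ℝ (Fin 4)} (hy : y ∈ (extChartAt (𝓡 4) x₀).target) :
    DifferentiableAt ℝ (ι ∘ (extChartAt (𝓡 4) x₀).symm) y :=
  ((contDiffOn_comp_extChartAt_symm hι x₀).differentiableOn (by simp)).differentiableAt
    ((isOpen_extChartAt_target (I := 𝓡 4) x₀).mem_nhds hy)

/-- The derivative `y ↦ D(ι ∘ e₀.symm)(y)` is continuous at every point of the chart target. -/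
theorem continuousAt_fderiv_comp_extChartAt_symm
    (hι : ContMDiff (𝓡 4) 𝓘(ℝ, EuclideanSpace ℝ (Fin N)) ∞ ι) (x₀ : S.carrier)
    {y : EuclideanSpace ℝ (Fin 4)} (hy : y ∈ (extChartAt (𝓡 4) x₀).target) :
    ContinuousAt (fderiv ℝ (ι ∘ (extChartAt (𝓡 4) x₀).symm)) y :=
  ((contDiffOn_comp_extChartAt_symm hι x₀).continuousOn_fderiv_of_isOpen
    (isOpen_extChartAt_target (I := 𝓡 4) x₀) (by simp)).continuousAt
    ((isOpen_extChartAt_target (I := 𝓡 4) x₀).mem_nhds hy)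

/-- Chain rule in the chart: at a point `x` of the source of the extended chart `e₀` at `x₀`,
`Dι(x) v = D(ι ∘ e₀.symm)(e₀ x) (De₀(x) v)`. -/
theorem mfderiv_apply_eq_fderiv_chart
    (hι : ContMDiff (𝓡 4) 𝓘(ℝ, EuclideanSpace ℝ (Fin N)) ∞ ι) (x₀ : S.carrier) {x : S.carrier}
    (hx : x ∈ (extChartAt (𝓡 4) x₀).source) (v : TangentSpace (𝓡 4) x) :
    mfderiv (𝓡 4) 𝓘(ℝ, EuclideanSpace ℝ (Fin N)) ι x v =
      fderiv ℝ (ι ∘ (extChartAt (𝓡 4) x₀).symm) (extChartAt (𝓡 4) x₀ x)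
        (mfderiv (𝓡 4) 𝓘(ℝ, EuclideanSpace ℝ (Fin 4)) (extChartAt (𝓡 4) x₀) x v) := by
  have heq : ι =ᶠ[𝓝 x] (ι ∘ (extChartAt (𝓡 4) x₀).symm) ∘ (extChartAt (𝓡 4) x₀) := by
    filter_upwards [(isOpen_extChartAt_source (I := 𝓡 4) x₀).mem_nhds hx] with y hy
    simp only [Function.comp_apply, (extChartAt (𝓡 4) x₀).left_inv hy]
  rw [heq.mfderiv_eq]
  have hF : MDifferentiableAt 𝓘(ℝ, EuclideanSpace ℝ (Fin 4)) 𝓘(ℝ, EuclideanSpace ℝ (Fin N))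
      (ι ∘ (extChartAt (𝓡 4) x₀).symm) (extChartAt (𝓡 4) x₀ x) :=
    mdifferentiableAt_iff_differentiableAt.2
      (differentiableAt_comp_extChartAt_symm hι x₀ ((extChartAt (𝓡 4) x₀).map_source hx))
  have he : MDifferentiableAt (𝓡 4) 𝓘(ℝ, EuclideanSpace ℝ (Fin 4)) (extChartAt (𝓡 4) x₀) x :=
    mdifferentiableAt_extChartAt (by rwa [← extChartAt_source (I := 𝓡 4)])
  rw [mfderiv_comp x hF he, mfderiv_eq_fderiv]
  rfl

/-- Chain rule for a smooth curve read in the chart: for a smooth `f : ℂ → Σ` with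
`f ξ ∈ e₀.source`, `D(ι ∘ f)(ξ) = D(ι ∘ e₀.symm)(e₀ (f ξ)) ∘ D(e₀ ∘ f)(ξ)`. -/
theorem fderiv_comp_curve_eq (hι : ContMDiff (𝓡 4) 𝓘(ℝ, EuclideanSpace ℝ (Fin N)) ∞ ι)
    {f : ℂ → S.carrier} (hf : ContMDiff 𝓘(ℝ, ℂ) (𝓡 4) ∞ f) (x₀ : S.carrier) {ξ : ℂ}
    (hξ : f ξ ∈ (extChartAt (𝓡 4) x₀).source) :
    fderiv ℝ (fun ζ : ℂ => ι (f ζ)) ξ =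
      (fderiv ℝ (ι ∘ (extChartAt (𝓡 4) x₀).symm) (extChartAt (𝓡 4) x₀ (f ξ))).comp
        (fderiv ℝ (fun ζ : ℂ => extChartAt (𝓡 4) x₀ (f ζ)) ξ) := by
  have hmem : ∀ᶠ ζ in 𝓝 ξ, f ζ ∈ (extChartAt (𝓡 4) x₀).source :=
    hf.continuous.continuousAt.preimage_mem_nhds
      ((isOpen_extChartAt_source (I := 𝓡 4) x₀).mem_nhds hξ)
  have heq : (fun ζ : ℂ => ι (f ζ)) =ᶠ[𝓝 ξ]
      (ι ∘ (extChartAt (𝓡 4) x₀).symm) ∘ (fun ζ : ℂ => extChartAt (𝓡 4) x₀ (f ζ)) := by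
    filter_upwards [hmem] with ζ hζ
    simp only [Function.comp_apply, (extChartAt (𝓡 4) x₀).left_inv hζ]
  rw [heq.fderiv_eq]
  have hd : DifferentiableAt ℝ (fun ζ : ℂ => extChartAt (𝓡 4) x₀ (f ζ)) ξ :=
    mdifferentiableAt_iff_differentiableAt.1
      (((contMDiffAt_extChartAt' (I := 𝓡 4) (n := ∞)
        (by rwa [← extChartAt_source (I := 𝓡 4)])).comp ξ (hf ξ)).mdifferentiableAt (by simp))
  exact fderiv_comp ξ
    (differentiableAt_comp_extChartAt_symm hι x₀ ((extChartAt (𝓡 4) x₀).map_source hξ)) hd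

end Chart

/-! ### Comparability of the differentials of two maps, the first an immersion -/

/-- Elementary perturbation estimate: if `‖w‖ ≤ K ‖T₀ w‖` for all `w` (`K ≥ 0`) and
`‖T - T₀‖ K ≤ 1/2`, then `‖w‖ ≤ 2 K ‖T w‖`. -/
theorem norm_le_two_mul_of_norm_sub_le {E F : Type*} [NormedAddCommGroup E] [NormedSpace ℝ E]
    [NormedAddCommGroup F] [NormedSpace ℝ F] {T₀ T : E →L[ℝ] F} {K : ℝ} (hK : 0 ≤ K)
    (hT₀ : ∀ w, ‖w‖ ≤ K * ‖T₀ w‖) (hT : ‖T - T₀‖ * K ≤ 1 / 2) (w : E) :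
    ‖w‖ ≤ 2 * K * ‖T w‖ := by
  have h1 : ‖T₀ w‖ ≤ ‖T w‖ + ‖T - T₀‖ * ‖w‖ := by
    calc ‖T₀ w‖ = ‖T w - (T - T₀) w‖ := by simp
      _ ≤ ‖T w‖ + ‖(T - T₀) w‖ := norm_sub_le _ _
      _ ≤ ‖T w‖ + ‖T - T₀‖ * ‖w‖ := by gcongr; exact (T - T₀).le_opNorm w
  have h2 : ‖T - T₀‖ * ‖w‖ * K ≤ ‖w‖ / 2 := by nlinarith [norm_nonneg w]
  nlinarith [hT₀ w, norm_nonneg (T w)]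

section Key

variable {N₁ N₂ : ℕ} {ι₁ : S.carrier → EuclideanSpace ℝ (Fin N₁)}
  {ι₂ : S.carrier → EuclideanSpace ℝ (Fin N₂)}

/-- If `ι₁` is an immersion, then at the centre of the chart `D(ι₁ ∘ e₀.symm)(e₀ x₀)` is injective
(`Dι₁(x₀) = D(ι₁ ∘ e₀.symm)(e₀ x₀) ∘ De₀(x₀)` with `De₀(x₀)` invertible). -/
theorem injective_fderiv_comp_extChartAt_symm
    (h₁ : ContMDiff (𝓡 4) 𝓘(ℝ, EuclideanSpace ℝ (Fin N₁)) ∞ ι₁)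
    (hinj : ∀ x : S.carrier,
      Function.Injective (mfderiv (𝓡 4) 𝓘(ℝ, EuclideanSpace ℝ (Fin N₁)) ι₁ x))
    (x₀ : S.carrier) :
    Function.Injective
      (fderiv ℝ (ι₁ ∘ (extChartAt (𝓡 4) x₀).symm) (extChartAt (𝓡 4) x₀ x₀)) := by
  have hsurj : Function.Surjective
      (mfderiv (𝓡 4) 𝓘(ℝ, EuclideanSpace ℝ (Fin 4)) (extChartAt (𝓡 4) x₀) x₀) :=
    (isInvertible_mfderiv_extChartAt (mem_extChartAt_source (I := 𝓡 4) x₀)).surjective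
  intro w w' hww'
  obtain ⟨v, rfl⟩ := hsurj w
  obtain ⟨v', rfl⟩ := hsurj w'
  rw [← mfderiv_apply_eq_fderiv_chart h₁ x₀ (mem_extChartAt_source (I := 𝓡 4) x₀) v,
    ← mfderiv_apply_eq_fderiv_chart h₁ x₀ (mem_extChartAt_source (I := 𝓡 4) x₀) v'] at hww'
  rw [hinj x₀ hww']

/-- Local comparability in the chart at `x₀`: near `e₀ x₀`,
`‖D(ι₂ ∘ e₀.symm)(y) w‖ ≤ C ‖D(ι₁ ∘ e₀.symm)(y) w‖` for all `w`. -/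
theorem exists_eventually_norm_fderiv_chart_le
    (h₁ : ContMDiff (𝓡 4) 𝓘(ℝ, EuclideanSpace ℝ (Fin N₁)) ∞ ι₁)
    (h₂ : ContMDiff (𝓡 4) 𝓘(ℝ, EuclideanSpace ℝ (Fin N₂)) ∞ ι₂)
    (hinj : ∀ x : S.carrier,
      Function.Injective (mfderiv (𝓡 4) 𝓘(ℝ, EuclideanSpace ℝ (Fin N₁)) ι₁ x))
    (x₀ : S.carrier) :
    ∃ C : ℝ, ∀ᶠ y in 𝓝 (extChartAt (𝓡 4) x₀ x₀), ∀ w : EuclideanSpace ℝ (Fin 4),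
      ‖fderiv ℝ (ι₂ ∘ (extChartAt (𝓡 4) x₀).symm) y w‖ ≤
        C * ‖fderiv ℝ (ι₁ ∘ (extChartAt (𝓡 4) x₀).symm) y w‖ := by
  have hy₀ : extChartAt (𝓡 4) x₀ x₀ ∈ (extChartAt (𝓡 4) x₀).target :=
    mem_extChartAt_target (I := 𝓡 4) x₀
  -- an injective linear map of `ℝ⁴` is bounded below
  obtain ⟨K, hK, hanti⟩ :=
    (fderiv ℝ (ι₁ ∘ (extChartAt (𝓡 4) x₀).symm)
      (extChartAt (𝓡 4) x₀ x₀)).injective_iff_antilipschitz.mp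
      (injective_fderiv_comp_extChartAt_symm h₁ hinj x₀)
  have hbound : ∀ w : EuclideanSpace ℝ (Fin 4),
      ‖w‖ ≤ K * ‖fderiv ℝ (ι₁ ∘ (extChartAt (𝓡 4) x₀).symm) (extChartAt (𝓡 4) x₀ x₀) w‖ :=
    (fderiv ℝ (ι₁ ∘ (extChartAt (𝓡 4) x₀).symm) (extChartAt (𝓡 4) x₀ x₀)).bound_of_antilipschitz
      hanti
  have hK' : (0 : ℝ) < K := NNReal.coe_pos.2 hK
  -- continuity of the two derivatives at the centre
  have hev₁ : ∀ᶠ y in 𝓝 (extChartAt (𝓡 4) x₀ x₀),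
      dist (fderiv ℝ (ι₁ ∘ (extChartAt (𝓡 4) x₀).symm) y)
        (fderiv ℝ (ι₁ ∘ (extChartAt (𝓡 4) x₀).symm) (extChartAt (𝓡 4) x₀ x₀)) <
          (2 * (K : ℝ))⁻¹ :=
    Metric.tendsto_nhds.1 (continuousAt_fderiv_comp_extChartAt_symm h₁ x₀ hy₀) _ (by positivity)
  have hev₂ : ∀ᶠ y in 𝓝 (extChartAt (𝓡 4) x₀ x₀),
      dist (fderiv ℝ (ι₂ ∘ (extChartAt (𝓡 4) x₀).symm) y)
        (fderiv ℝ (ι₂ ∘ (extChartAt (𝓡 4) x₀).symm) (extChartAt (𝓡 4) x₀ x₀)) < 1 :=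
    Metric.tendsto_nhds.1 (continuousAt_fderiv_comp_extChartAt_symm h₂ x₀ hy₀) _ one_pos
  refine ⟨2 * K * (‖fderiv ℝ (ι₂ ∘ (extChartAt (𝓡 4) x₀).symm) (extChartAt (𝓡 4) x₀ x₀)‖ + 1),
    ?_⟩
  filter_upwards [hev₁, hev₂] with y hy₁ hy₂ w
  rw [dist_eq_norm] at hy₁ hy₂
  have hT : ‖fderiv ℝ (ι₁ ∘ (extChartAt (𝓡 4) x₀).symm) y -
      fderiv ℝ (ι₁ ∘ (extChartAt (𝓡 4) x₀).symm) (extChartAt (𝓡 4) x₀ x₀)‖ * K ≤ 1 / 2 := by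
    calc ‖fderiv ℝ (ι₁ ∘ (extChartAt (𝓡 4) x₀).symm) y -
          fderiv ℝ (ι₁ ∘ (extChartAt (𝓡 4) x₀).symm) (extChartAt (𝓡 4) x₀ x₀)‖ * K
        ≤ (2 * (K : ℝ))⁻¹ * K := by gcongr
      _ = 1 / 2 := by field_simp
  have hw : ‖w‖ ≤ 2 * K * ‖fderiv ℝ (ι₁ ∘ (extChartAt (𝓡 4) x₀).symm) y w‖ :=
    norm_le_two_mul_of_norm_sub_le hK'.le hbound hT w
  have hR : ‖fderiv ℝ (ι₂ ∘ (extChartAt (𝓡 4) x₀).symm) y‖ ≤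
      ‖fderiv ℝ (ι₂ ∘ (extChartAt (𝓡 4) x₀).symm) (extChartAt (𝓡 4) x₀ x₀)‖ + 1 :=
    (norm_le_norm_add_norm_sub' _ _).trans (by linarith)
  calc ‖fderiv ℝ (ι₂ ∘ (extChartAt (𝓡 4) x₀).symm) y w‖
      ≤ ‖fderiv ℝ (ι₂ ∘ (extChartAt (𝓡 4) x₀).symm) y‖ * ‖w‖ :=
        (fderiv ℝ (ι₂ ∘ (extChartAt (𝓡 4) x₀).symm) y).le_opNorm w
    _ ≤ (‖fderiv ℝ (ι₂ ∘ (extChartAt (𝓡 4) x₀).symm) (extChartAt (𝓡 4) x₀ x₀)‖ + 1) *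
          (2 * K * ‖fderiv ℝ (ι₁ ∘ (extChartAt (𝓡 4) x₀).symm) y w‖) := by
        gcongr
    _ = 2 * K * (‖fderiv ℝ (ι₂ ∘ (extChartAt (𝓡 4) x₀).symm) (extChartAt (𝓡 4) x₀ x₀)‖ + 1) *
          ‖fderiv ℝ (ι₁ ∘ (extChartAt (𝓡 4) x₀).symm) y w‖ := by ring

/-- KEY ESTIMATE — global comparability by compactness of `Σ`: one constant `C ≥ 0` such that
every point `x` lies in the source of an extended chart `e₀` (at some `x₀`) in which
`‖D(ι₂ ∘ e₀.symm)(e₀ x) w‖ ≤ C ‖D(ι₁ ∘ e₀.symm)(e₀ x) w‖` for all `w`. -/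
theorem exists_norm_fderiv_chart_le
    (h₁ : ContMDiff (𝓡 4) 𝓘(ℝ, EuclideanSpace ℝ (Fin N₁)) ∞ ι₁)
    (h₂ : ContMDiff (𝓡 4) 𝓘(ℝ, EuclideanSpace ℝ (Fin N₂)) ∞ ι₂)
    (hinj : ∀ x : S.carrier,
      Function.Injective (mfderiv (𝓡 4) 𝓘(ℝ, EuclideanSpace ℝ (Fin N₁)) ι₁ x)) :
    ∃ C : ℝ, 0 ≤ C ∧ ∀ x : S.carrier, ∃ x₀ : S.carrier, x ∈ (extChartAt (𝓡 4) x₀).source ∧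
      ∀ w : EuclideanSpace ℝ (Fin 4),
        ‖fderiv ℝ (ι₂ ∘ (extChartAt (𝓡 4) x₀).symm) (extChartAt (𝓡 4) x₀ x) w‖ ≤
          C * ‖fderiv ℝ (ι₁ ∘ (extChartAt (𝓡 4) x₀).symm) (extChartAt (𝓡 4) x₀ x) w‖ := by
  choose C hC using fun x₀ => exists_eventually_norm_fderiv_chart_le h₁ h₂ hinj x₀
  -- the neighbourhoods on which the local constants work
  set U : S.carrier → Set S.carrier := fun x₀ =>
    (extChartAt (𝓡 4) x₀).source ∩ {x | ∀ w : EuclideanSpace ℝ (Fin 4),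
      ‖fderiv ℝ (ι₂ ∘ (extChartAt (𝓡 4) x₀).symm) (extChartAt (𝓡 4) x₀ x) w‖ ≤
        C x₀ * ‖fderiv ℝ (ι₁ ∘ (extChartAt (𝓡 4) x₀).symm) (extChartAt (𝓡 4) x₀ x) w‖}
  have hUn : ∀ x₀, U x₀ ∈ 𝓝 x₀ := fun x₀ =>
    inter_mem (extChartAt_source_mem_nhds (I := 𝓡 4) x₀)
      ((continuousAt_extChartAt (I := 𝓡 4) x₀).tendsto.eventually (hC x₀))
  obtain ⟨t, ht⟩ := CompactSpace.elim_nhds_subcover U hUn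
  refine ⟨∑ x₀ ∈ t, max (C x₀) 0, Finset.sum_nonneg fun _ _ => le_max_right _ _, fun x => ?_⟩
  have hx : x ∈ ⋃ x₀ ∈ t, U x₀ := by rw [ht]; trivial
  obtain ⟨x₀, hx₀t, hx₀, hle⟩ := mem_iUnion₂.1 hx
  exact ⟨x₀, hx₀, fun w => (hle w).trans (mul_le_mul_of_nonneg_right ((le_max_left _ _).trans
    (Finset.single_le_sum (f := fun x₀ => max (C x₀) 0) (fun _ _ => le_max_right _ _) hx₀t))
    (norm_nonneg _))⟩

/-- ENERGY DENSITY: under the conclusion of `exists_norm_fderiv_chart_le`, every smooth curve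
`u : ℂ → Σ ∖ p` satisfies `‖d(ι₂ ∘ u)(ξ)‖ ≤ C ‖d(ι₁ ∘ u)(ξ)‖` at every `ξ` (chain rule through the
chart at `u ξ`, with the same inner derivative `d(e₀ ∘ u)(ξ)` for both maps). -/
theorem norm_fderiv_curve_le (h₁ : ContMDiff (𝓡 4) 𝓘(ℝ, EuclideanSpace ℝ (Fin N₁)) ∞ ι₁)
    (h₂ : ContMDiff (𝓡 4) 𝓘(ℝ, EuclideanSpace ℝ (Fin N₂)) ∞ ι₂) {C : ℝ} (hC0 : 0 ≤ C)
    (hC : ∀ x : S.carrier, ∃ x₀ : S.carrier, x ∈ (extChartAt (𝓡 4) x₀).source ∧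
      ∀ w : EuclideanSpace ℝ (Fin 4),
        ‖fderiv ℝ (ι₂ ∘ (extChartAt (𝓡 4) x₀).symm) (extChartAt (𝓡 4) x₀ x) w‖ ≤
          C * ‖fderiv ℝ (ι₁ ∘ (extChartAt (𝓡 4) x₀).symm) (extChartAt (𝓡 4) x₀ x) w‖)
    {p : S.carrier} {u : ℂ → punctured p} (hu : ContMDiff 𝓘(ℝ, ℂ) (𝓡 4) ∞ u) (ξ : ℂ) :
    ‖fderiv ℝ (fun ζ : ℂ => ι₂ (u ζ).1) ξ‖ ≤ C * ‖fderiv ℝ (fun ζ : ℂ => ι₁ (u ζ).1) ξ‖ := by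
  have hf : ContMDiff 𝓘(ℝ, ℂ) (𝓡 4) ∞ (fun ζ : ℂ => (u ζ).1) := contMDiff_subtype_val.comp hu
  obtain ⟨x₀, hx, hle⟩ := hC (u ξ).1
  rw [fderiv_comp_curve_eq h₂ hf x₀ hx, fderiv_comp_curve_eq h₁ hf x₀ hx]
  refine ContinuousLinearMap.opNorm_le_bound _ (by positivity) fun ζ' => ?_
  have hop := ((fderiv ℝ (ι₁ ∘ (extChartAt (𝓡 4) x₀).symm) (extChartAt (𝓡 4) x₀ (u ξ).1)).comp
    (fderiv ℝ (fun ζ : ℂ => extChartAt (𝓡 4) x₀ (u ζ).1) ξ)).le_opNorm ζ'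
  rw [ContinuousLinearMap.comp_apply] at hop ⊢
  rw [mul_assoc]
  exact (hle _).trans (mul_le_mul_of_nonneg_left hop hC0)

end Key

/-! ### The registered helper -/

/-- **Registered helper `helper_lineEnergy_le_of_immersion`** (line `crofton-pencil-laminar-charge`,
crux `Target`): for a smooth IMMERSION `ι₁ : Σ → ℝ^{N₁}` and any smooth `ι₂ : Σ → ℝ^{N₂}` of the
compact `Σ`, the energies of all smooth curves `u : ℂ → Σ ∖ p` are comparable,
`lineEnergy ι₂ u ≤ C · lineEnergy ι₁ u`, with `C` depending only on `(Σ, ι₁, ι₂)` — any two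
smooth immersions give comparable energies. -/
theorem helper_lineEnergy_le_of_immersion :
    ∀ (S : HomotopySphere 4) (p : S.carrier) (N₁ N₂ : ℕ)
      (ι₁ : S.carrier → EuclideanSpace ℝ (Fin N₁)) (ι₂ : S.carrier → EuclideanSpace ℝ (Fin N₂)),
      ContMDiff (𝓡 4) 𝓘(ℝ, EuclideanSpace ℝ (Fin N₁)) ∞ ι₁ →
      ContMDiff (𝓡 4) 𝓘(ℝ, EuclideanSpace ℝ (Fin N₂)) ∞ ι₂ →
      (∀ x : S.carrier, Function.Injective (mfderiv (𝓡 4) 𝓘(ℝ, EuclideanSpace ℝ (Fin N₁)) ι₁ x)) →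
      ∃ C : ℝ≥0, ∀ u : ℂ → punctured p, ContMDiff 𝓘(ℝ, ℂ) (𝓡 4) ∞ u →
        lineEnergy ι₂ u ≤ (C : ℝ≥0∞) * lineEnergy ι₁ u := by
  intro S p N₁ N₂ ι₁ ι₂ h₁ h₂ hinj
  obtain ⟨C, hC0, hC⟩ := exists_norm_fderiv_chart_le h₁ h₂ hinj
  refine ⟨(C ^ 2).toNNReal, fun u hu => ?_⟩
  rw [ENNReal.ofNNReal_toNNReal]
  unfold lineEnergy
  rw [← lintegral_const_mul' _ _ ENNReal.ofReal_ne_top]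
  refine lintegral_mono fun ξ => ?_
  rw [← ENNReal.ofReal_mul (sq_nonneg C), ← mul_pow]
  exact ENNReal.ofReal_le_ofReal
    (pow_le_pow_left₀ (norm_nonneg _) (norm_fderiv_curve_le h₁ h₂ hC0 hC hu ξ) 2)

end Summit.SmoothPoincare4.SmoothPoincare4.Theorems.Target.CroftonPencil

end
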